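/-
Copyright (c) 2026 the pub-hodgecm-mathlib formalisation cell (harness21).  Prover seat hodgecm-mathlib-LH7-p06 (g0) (re-dealt to strike line L3 `stub_N6nsDyadic` by director
s1969 (a)), «(D-RAM) FOUR-FRAME» road of crux H413, line LH4, (β-BAL) Stage B, β-BOARD v1 (sub-dealer LH4-p05 (g8)) ROW R5b «G₃ ε-BOUNDARY, THE TWO-SLOT CORE» (HEAD = this seat,
orbit layer = LH4-p18 (g0), bus 2026-09-04T15:45–15:48Z), STEP (β1): THE PER-LATTICE VALUE IN ABSTRACT-INDICATOR FORM.  2026-09-04.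
-/
import Summits.HodgeConjecture.HodgeConjecture.Theorems.F0P3cDyRamLabelledOddBoundaryLatticeG3   -- ★ p861535 (this seat): `twoSlotLabel_latt_G3`, `linear_eq_sum_mul_one_add`, `v_linearSum_latt_G3`, `v_correction_latt_G3`; brings ★ p13 two-slot read, ★ p861251 G₃ infrastructure, ★ `fibre_isCoset_zero`
import Summits.HodgeConjecture.HodgeConjecture.Theorems.F0P3cDyRamLabelledOddCharacterRead     -- ★ p861456 (LH4-p17 (g0)): HEAD A′-χ `labelledOddCount_div_relIndex_eq_of_character`; brings ★ p860847 `classSign_mul_eq_of_label`, ★ `map_unitNormMap_unitStabilizer_le`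
import Summits.HodgeConjecture.HodgeConjecture.Theorems.F0P3cDyRamValueClassLabelEquivariant    -- ★ p860316 (LH4-p11 (g8)): `isTorusEquivariantLabel_valueClassLabel`
import Summits.HodgeConjecture.HodgeConjecture.Theorems.F0P3cDyRamDiagonalKappaSplitCountValues  -- ★ (LH4-p04): brings ★ `exists_nonnorm_dichotomy_of_isRamifiedQuadraticDatum`, ★ `normSign_mul_of_dichotomy`
import Literature.NumberTheory.LocalFields.WildQuadraticDatumNormSignConductor                    -- ★ (B-p04): `normSign_mul_eq_of_fixed_of_v_sub_one_le` (units `≡ 1 (mod ϖ^{2d−1})` are norms), `normSign_mul_of_fixed`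
import HarnessLib

/-!
# Crux `H413`, line LH4 «(D-RAM) FOUR-FRAME» — (β-BAL) Stage B, β-BOARD v1 ROW R5b «G₃ ε-BOUNDARY, TWO-SLOT CORE», STEP (β1):
# the labelled odd value of a G₃ normal form on the capped tube is `ω(G₀+G₁)·ω(D_i)∕2 · [ω_i·λ ≡ 1 on S_F] · stabiliserWeight`, `λ(u) = ω(u₀)·ω(1 + (u₁∕u₀ − 1)·c)` a CHARACTER

Cell `hodgecm-mathlib` (D-0151), FLOOR 0, crux item H413 = `stmt-HodgeConjecture-24833`, route `HCCMUnconditional`; squad F0∕P3c∕LH4.  THEOREMS ONLY (no `def`, no instance, no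
notation, no `sorry`, default heartbeats); ★-only imports; lane `--supports stmt-HodgeConjecture-24833 --as helper` (count-neutral); pays NO row, states NO law.

THE MATHEMATICS (LH4-p17 (g0)'s R3 character mechanism, in G₃ letters).  On the G₃ normal form `M₀ = latt (1 0 0; x ϖ^{ρ+s} 0; y z ϖ^{2ρ})` with polarisation `D`, on the read
`2k₃ + ℓ₀ = n₃ = 2ρ+s+ℓ₀` with `2k₁ + ℓ₀ = n₁ ≥ 2ρ + ℓ₀ + 1` (the whole capped tube), ★ p861535 `twoSlotLabel_latt_G3` reads the value-class label on the fibre `D·S_F(M₀)` as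
`ω(u₀G₀ + u₁G₁) = 1`, `G₀ = D₀(π₀^{k₁}e_B − π₀^{k₃}e_C)`, `G₁ = D₁N(x)π₀^{k₁}e_B`; by ★ `linear_eq_sum_mul_one_add` and ★ `v_linearSum_latt_G3` (`S = G₀ + G₁` a σ-fixed UNIT)
this is `ε·λ(u) = 1` with `ε = ω(S)` and **`λ(u) = ω(u₀)·ω(1 + (u₁∕u₀ − 1)·c)`**, `c = G₁∕S`.  §1: `λ` is `{±1}`-valued and MULTIPLICATIVE on `S_F(M₀)`: `ω` is multiplicative on fixed
non-zero elements (★ `normSign_mul_of_fixed`), and for `t, t′ ∈ u₁∕u₀(S_F) ⊆ U_F(ρ+s)` one has `(1 + (t−1)c)(1 + (t′−1)c) = (1 + (tt′−1)c)·w` with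
`|w − 1| = |(t−1)(t′−1)·c·(c−1)| ∕ |1 + (tt′−1)c| ≤ |ϖ|^{2ρ+2s}·|c|·max(|c|, 1) ≤ |ϖ|^{2d−1}` (★ `v_correction_latt_G3`-type depths: `|c| = |ϖ|^{n₁−n₃}`, and `n₁ ≥ mc ≥ 3d−2+ℓ₀`),
so `ω` does not see `w` (★ `normSign_mul_eq_of_fixed_of_v_sub_one_le`); `λ ≡ 1` on `N(S̃′)` by torus-equivariance (★ `isTorusEquivariantLabel_valueClassLabel` ∘ ★ `classSign_mul_eq_of_label`).
§2 HEAD **`labelledOddCount_div_relIndex_twoSlot_latt_G3`** = ★ p861456 HEAD A′-χ `labelledOddCount_div_relIndex_eq_of_character` on these letters: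
`labelledOddCount σ ϖ 0 i Λ M₀ ∕ [𝒰 : N(S̃′(M₀))] = ω(S)·ω(D_i)∕2 · [∀ u ∈ S_F(M₀), ω(u_i)·λ(u) = 1] · stabiliserWeight σ M₀` for `Λ = valueClassLabel σ ϖ (α−1) (β−1) m* d`
— the G₃ boundary value with the INDICATOR LEFT ABSTRACT (step (β2) evaluates the three indicators by depth against the conductor `2d − 1`; step (β3) sums over LH4-p18 (g0)'s
orbit decomposition).  HONEST LABEL: count-neutral per-lattice bookkeeping; R5b, the table identity (SIG-B2b3), (β-BAL), (β), T₊ remain OPEN; `HC_CM` is proved only modulo the 7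
printed citations (2 remaining named inputs: hLiu418 = `stmt-HodgeConjecture-24832`, h413 = `stmt-HodgeConjecture-24833`) until rung 0 closes.

## References
* [Kottwitz1986BaseChangeUnits] R. E. Kottwitz, *Base change for unit elements of Hecke algebras*, Compositio Math. 60 (1986), §1 pp. 240–241 (signed lattice counts by torus orbits).
* [LanglandsShelstad1987] R. P. Langlands, D. Shelstad, *On the definition of transfer factors*, Math. Ann. 278 (1987), §3 (κ as a character; signs of binary norm forms).
* [Serre1979] J.-P. Serre, *Local Fields*, GTM 67 (1979), Ch. V §3 Prop. 5, Cor. 2–3 (norm groups and the conductor of a ramified quadratic extension), Ch. XV §2.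
* [Rogawski1990] J. D. Rogawski, *Automorphic Representations of Unitary Groups in Three Variables*, Ann. of Math. Stud. 123 (1990), §4.9 Prop. 4.9.1 (a)(b) p. 55, §4.10 p. 58.
-/

set_option autoImplicit false

noncomputable section

namespace Summit.HodgeConjecture.HodgeConjecture.Cruxes.H413.F0P3cDyRamLabelledOddBoundaryValueG3

open Literature.NumberTheory.Automorphic Literature.NumberTheory.Automorphic.HermitianLattice
open Literature.NumberTheory.Automorphic.UnitaryLatticeTree Literature.NumberTheory.Automorphic.UnitaryThreeFourFrame
open Literature.NumberTheory.LocalFields Literature.NumberTheory.LocalFields.WildQuadraticDatum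
open Summit.HodgeConjecture.HodgeConjecture.Cruxes.H413.F0P3cDyRamFourFramePieces
open Summit.HodgeConjecture.HodgeConjecture.Cruxes.H413.F0P3cDyRamFourFrameCensusDefs
open Summit.HodgeConjecture.HodgeConjecture.Cruxes.H413.F0P3cDyRamStageOneBDefs (mcOfRecord)
open Summit.HodgeConjecture.HodgeConjecture.Cruxes.H413.F0P3cDyRamDiagonalTorusDefs
open Summit.HodgeConjecture.HodgeConjecture.Cruxes.H413.F0P3cDyRamDiagonalStrataDefs
open Summit.HodgeConjecture.HodgeConjecture.Cruxes.H413.F0P3cDyRamLabelledOddCountDefs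
open Summit.HodgeConjecture.HodgeConjecture.Cruxes.H413.F0P3cDyRamStableSumSignClasses (normSign_eq_one_or)
open Summit.HodgeConjecture.HodgeConjecture.Cruxes.H413.F0P3cDyRamDiagonalOrbitFibreTransport (fibre_isCoset_zero)
open Summit.HodgeConjecture.HodgeConjecture.Cruxes.H413.F0P3cDyRamDiagonalGluedStratumG3
open Summit.HodgeConjecture.HodgeConjecture.Cruxes.H413.F0P3cDyRamLabelledOddBoundaryLatticeG3
open Summit.HodgeConjecture.HodgeConjecture.Cruxes.H413.F0P3cDyRamValueClassLabelEquivariant (isTorusEquivariantLabel_valueClassLabel)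
open Summit.HodgeConjecture.HodgeConjecture.Cruxes.H413.F0P3cDyRamLabelledOddOneSlotRead (map_unitNormMap_unitStabilizer_le)
open Summit.HodgeConjecture.HodgeConjecture.Cruxes.H413.F0P3cDyRamLabelledOddClassSignRead (classSign_mul_eq_of_label)
open Summit.HodgeConjecture.HodgeConjecture.Cruxes.H413.F0P3cDyRamLabelledOddCharacterRead (labelledOddCount_div_relIndex_eq_of_character)
open Summit.HodgeConjecture.HodgeConjecture.Cruxes.H413.F0P3cDyRamDiagonalKappaSplitCountValues
open scoped Valued WithZero Matrix MatrixGroups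

variable {K : Type} [Field K] [Valued K ℤᵐ⁰] [CompleteSpace K] {σ : K →+* K} {ϖ : K} {d t : ℕ}

/-! ## §1  The correction character `t ↦ ω(1 + (t − 1)·c)` is multiplicative on `U_F(r)` under the conductor depth condition -/

/-- **MULTIPLICATIVITY OF THE CORRECTION FACTOR.**  `c` σ-fixed, `r ≥ 1`, `|ϖ^r|·|c| < 1` and the DEPTH CONDITION `|ϖ^r|·|ϖ^r|·|c|·max(|c|, 1) ≤ |ϖ|^{2d−1}`; then for σ-fixed `t, t′` with
`|t − 1|, |t′ − 1| ≤ |ϖ^r|`: `ω(1 + (tt′−1)c) = ω(1 + (t−1)c)·ω(1 + (t′−1)c)` — since `(1 + (t−1)c)(1 + (t′−1)c) = (1 + (tt′−1)c)·w` with `w − 1 = (t−1)(t′−1)c(c−1)∕(1 + (tt′−1)c)`,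
a fixed unit `≡ 1 (mod ϖ^{2d−1})`, i.e. a norm (★ `normSign_mul_eq_of_fixed_of_v_sub_one_le`). [cite: Serre1979, Ch. V §3 Cor. 3; Ch. XV §2] -/
theorem normSign_one_add_mul_mul [Finite 𝓀[K]] (hD : IsRamifiedQuadraticDatum σ ϖ d t) {c : K} (hσc : σ c = c) {r : ℕ} (hr : 1 ≤ r)
    (hsmall : Valued.v (ϖ ^ r) * Valued.v c < 1) (hdepth : Valued.v (ϖ ^ r) * Valued.v (ϖ ^ r) * Valued.v c * max (Valued.v c) 1 ≤ Valued.v ϖ ^ (2 * d - 1))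
    {t t' : K} (hσt : σ t = t) (hσt' : σ t' = t') (ht : Valued.v (t - 1) ≤ Valued.v (ϖ ^ r)) (ht' : Valued.v (t' - 1) ≤ Valued.v (ϖ ^ r)) :
    normSign σ (1 + (t * t' - 1) * c) = normSign σ (1 + (t - 1) * c) * normSign σ (1 + (t' - 1) * c) := by
  have hD' := hD
  obtain ⟨hσ, hvσ, hϖ, -, -, -, -⟩ := hD'
  have hϖr1 : Valued.v (ϖ ^ r) < 1 := by
    rw [map_pow]; exact pow_lt_one₀ zero_le (by rw [hϖ, ← WithZero.exp_zero, WithZero.exp_lt_exp]; norm_num) (by omega)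
  have ht'1 : Valued.v t' = 1 := by
    rw [show t' = 1 + (t' - 1) by ring]; exact Valued.v.map_one_add_of_lt (ht'.trans_lt hϖr1)
  -- the three corrections are small
  have ha : Valued.v ((t - 1) * c) < 1 := by rw [map_mul]; exact (mul_le_mul' ht le_rfl).trans_lt hsmall
  have hb : Valued.v ((t' - 1) * c) < 1 := by rw [map_mul]; exact (mul_le_mul' ht' le_rfl).trans_lt hsmall
  have htt' : Valued.v (t * t' - 1) ≤ Valued.v (ϖ ^ r) := by
    rw [show t * t' - 1 = (t - 1) * t' + (t' - 1) by ring]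
    refine (Valuation.map_add _ _ _).trans (max_le ?_ ht')
    rw [map_mul, ht'1, mul_one]; exact ht
  have he : Valued.v ((t * t' - 1) * c) < 1 := by rw [map_mul]; exact (mul_le_mul' htt' le_rfl).trans_lt hsmall
  -- the three units `A = 1 + a`, `B = 1 + b`, `E = 1 + (tt′−1)c`
  have hA1 : Valued.v (1 + (t - 1) * c) = 1 := Valued.v.map_one_add_of_lt ha
  have hB1 : Valued.v (1 + (t' - 1) * c) = 1 := Valued.v.map_one_add_of_lt hb
  have hE1 : Valued.v (1 + (t * t' - 1) * c) = 1 := Valued.v.map_one_add_of_lt he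
  have hA0 : 1 + (t - 1) * c ≠ 0 := fun h => by rw [h, map_zero] at hA1; exact zero_ne_one hA1
  have hB0 : 1 + (t' - 1) * c ≠ 0 := fun h => by rw [h, map_zero] at hB1; exact zero_ne_one hB1
  have hE0 : 1 + (t * t' - 1) * c ≠ 0 := fun h => by rw [h, map_zero] at hE1; exact zero_ne_one hE1
  have hσA : σ (1 + (t - 1) * c) = 1 + (t - 1) * c := by rw [map_add, map_one, map_mul, map_sub, hσt, map_one, hσc]
  have hσB : σ (1 + (t' - 1) * c) = 1 + (t' - 1) * c := by rw [map_add, map_one, map_mul, map_sub, hσt', map_one, hσc]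
  have hσE : σ (1 + (t * t' - 1) * c) = 1 + (t * t' - 1) * c := by rw [map_add, map_one, map_mul, map_sub, map_mul, hσt, hσt', map_one, hσc]
  -- the quotient `w = AB∕E` and `w − 1 = (t−1)(t′−1)c(c−1)∕E`
  set w : K := (1 + (t - 1) * c) * (1 + (t' - 1) * c) / (1 + (t * t' - 1) * c) with hwdef
  have hAB : (1 + (t - 1) * c) * (1 + (t' - 1) * c) = (1 + (t * t' - 1) * c) * w := by rw [hwdef, mul_div_cancel₀ _ hE0]
  have hw1 : w - 1 = (t - 1) * (t' - 1) * c * (c - 1) / (1 + (t * t' - 1) * c) := by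
    rw [hwdef, eq_div_iff hE0, sub_mul, div_mul_cancel₀ _ hE0]; ring
  have hσw : σ w = w := by rw [hwdef, map_div₀, map_mul, hσA, hσB, hσE]
  have hc1 : Valued.v (c - 1) ≤ max (Valued.v c) 1 := by
    refine (Valuation.map_sub _ _ _).trans ?_
    rw [map_one]
  have hwv : Valued.v (w - 1) ≤ Valued.v ϖ ^ (2 * d - 1) := by
    rw [hw1, map_div₀, hE1, div_one, map_mul, map_mul, map_mul]
    calc Valued.v (t - 1) * Valued.v (t' - 1) * Valued.v c * Valued.v (c - 1)
        ≤ Valued.v (ϖ ^ r) * Valued.v (ϖ ^ r) * Valued.v c * max (Valued.v c) 1 := by gcongr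
      _ ≤ Valued.v ϖ ^ (2 * d - 1) := hdepth
  -- `ω(AB) = ω(E·w) = ω(E)` and `ω(AB) = ω(A)ω(B)`
  have h1 : normSign σ ((1 + (t - 1) * c) * (1 + (t' - 1) * c)) = normSign σ (1 + (t - 1) * c) * normSign σ (1 + (t' - 1) * c) :=
    normSign_mul_of_fixed hD hσA hσB hA0 hB0
  have h2 : normSign σ ((1 + (t * t' - 1) * c) * w) = normSign σ (1 + (t * t' - 1) * c) :=
    normSign_mul_eq_of_fixed_of_v_sub_one_le hD _ hσw (le_refl (2 * d - 1)) hwv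
  rw [← h1, hAB, h2]

/-! ## §2  HEAD (β1) — the labelled odd value of a G₃ normal form on the capped tube, indicator left abstract -/

section Head

variable [Fintype 𝓀[K]] {α β : K} {N₀ n₁ n₂ n₃ : ℕ}

open Classical in
/-- **THE G₃ BOUNDARY VALUE IN ABSTRACT-INDICATOR FORM (R5b step (β1)).**  On the G₃ normal form `M₀ = latt (1 0 0; x ϖ^{ρ+s} 0; y z ϖ^{2ρ})` (`|x| = |y| = 1`, `|z| = |ϖ|^ρ`)
with polarisation `D`, `T`-stable, on the clean shell, on the read `2k₃ + ℓ₀ = n₃ = 2ρ + s + ℓ₀` with half-depth `2k₁ + ℓ₀ = n₁ ≥ 2ρ + ℓ₀ + 1` and unit tokens `e_C` (of `β − α` at `k₃`),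
`e_B` (of `β − 1` at `k₁`): with `S = G₀ + G₁ = D₀(π₀^{k₁}e_B − π₀^{k₃}e_C) + D₁N(x)π₀^{k₁}e_B`, `G₁ = D₁N(x)π₀^{k₁}e_B`, `c = G₁∕S`,
`labelledOddCount σ ϖ 0 i (valueClassLabel σ ϖ (α−1) (β−1) m* d) M₀ ∕ [𝒰 : N(S̃′(M₀))] = ω(S)·ω(D_i)∕2 · [∀ u ∈ S_F(M₀), ω(u_i)·(ω(u₀)·ω(1 + (u₁∕u₀ − 1)·c)) = 1] · stabiliserWeight σ M₀`
(★ p861456 HEAD A′-χ on the character `λ(u) = ω(u₀)·ω(1 + (u₁∕u₀ − 1)·c)` of `S_F(M₀)`, §1 + ★ p861535). [cite: Kottwitz1986BaseChangeUnits, §1 pp. 240–241]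
[cite: LanglandsShelstad1987, §3] [cite: Serre1979, Ch. V §3 Cor. 3] [cite: Rogawski1990, §4.9 Prop. 4.9.1 (a)(b) p. 55, §4.10 p. 58] -/
theorem labelledOddCount_div_relIndex_twoSlot_latt_G3 (hD : IsRamifiedQuadraticDatum σ ϖ d t) (h2d : 2 ≤ d)
    (hE : IsElementDatum σ ϖ N₀ α β n₁ n₂ n₃) (hmc : mcOfRecord d ≤ N₀)
    (T : GL (Fin 3) K) (hT : (T : Matrix (Fin 3) (Fin 3) K) = Matrix.diagonal ![α, β, 1])
    {ρ s : ℕ} (hρ : 1 ≤ ρ) (hs : 1 ≤ s) {x y z : K} (hx : Valued.v x = 1) (hy : Valued.v y = 1) (hz : Valued.v z = Valued.v (ϖ ^ ρ))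
    (k₃ : ℕ) (hks : 2 * ρ + s = 2 * k₃) (hk₃ : 2 * k₃ + d % 2 = n₃) (k₁ : ℕ) (hk₁ : 2 * k₁ + d % 2 = n₁) (hn₁ : 2 * ρ + d % 2 + 1 ≤ n₁)
    {M₀ : Submodule 𝒪[K] (Fin 3 → K)} (hM₀ : M₀ = latt (!![1, 0, 0; x, ϖ ^ (ρ + s), 0; y, z, ϖ ^ (2 * ρ)] : Matrix (Fin 3) (Fin 3) K))
    (hTM : mapGL T M₀ = M₀) {D : Fin 3 → K} (hD₁ : ∀ j, σ (D j) = D j ∧ D j ≠ 0) (hV₁ : IsVertexLattice σ ϖ (Matrix.diagonal D) 0 M₀)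
    (hlev : LatticeInLevel ϖ (d % 2) (Matrix.diagonal ![α - 1, β - 1, 0]) M₀) (hnlev : ¬ LatticeInLevel ϖ (d % 2 + 1) (Matrix.diagonal ![α - 1, β - 1, 0]) M₀)
    (hsq : LatticeInLevel ϖ (mcOfRecord d) (Matrix.diagonal ![(α - 1) * (α - 1), (β - 1) * (β - 1), 0]) M₀)
    (hfin : {M : Submodule 𝒪[K] (Fin 3 → K) | ∃ u ∈ unitTorus K 3, M = mapGL (diagGLUnits u) M₀}.Finite)
    {eC : K} (hσeC : σ eC = eC) (heC1 : Valued.v eC = 1)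
    (heC : Valued.v ((ϖ ^ (d % 2 + 2 * d - 1))⁻¹ * ((β - α) * ((ϖ * σ ϖ) ^ k₃)⁻¹ - eC * ((ϖ - σ ϖ) * ((ϖ * σ ϖ) ^ ((d - d % 2) / 2))⁻¹))) ≤ 1)
    {eB : K} (hσeB : σ eB = eB) (heB1 : Valued.v eB = 1)
    (heB : Valued.v ((ϖ ^ (d % 2 + 2 * d - 1))⁻¹ * ((β - 1) * ((ϖ * σ ϖ) ^ k₁)⁻¹ - eB * ((ϖ - σ ϖ) * ((ϖ * σ ϖ) ^ ((d - d % 2) / 2))⁻¹))) ≤ 1) (i : Fin 3) :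
    (labelledOddCount σ ϖ 0 i (valueClassLabel σ ϖ (α - 1) (β - 1) (d % 2 + 2 * d - 1) d) M₀ : ℚ) /
        ((((unitStabilizer M₀).map (unitNormMap σ 3)).relIndex (fixedUnitTorus σ 3) : ℕ) : ℚ) =
      (normSign σ (D 0 * ((ϖ * σ ϖ) ^ k₁ * eB - (ϖ * σ ϖ) ^ k₃ * eC) + D 1 * (σ x * x) * ((ϖ * σ ϖ) ^ k₁ * eB)) : ℚ) * (normSign σ (D i) : ℚ) / 2 *
        ((if ∀ u ∈ fixedUnitStabilizer σ M₀,
              normSign σ ((u i : Kˣ) : K) *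
                  (normSign σ ((u 0 : Kˣ) : K) *
                    normSign σ (1 + (((u 1 : Kˣ) : K) / ((u 0 : Kˣ) : K) - 1) *
                      (D 1 * (σ x * x) * ((ϖ * σ ϖ) ^ k₁ * eB) /
                        (D 0 * ((ϖ * σ ϖ) ^ k₁ * eB - (ϖ * σ ϖ) ^ k₃ * eC) + D 1 * (σ x * x) * ((ϖ * σ ϖ) ^ k₁ * eB))))) = 1
            then 1 else 0 : ℤ) : ℚ) * stabiliserWeight σ M₀ := by
  have hD' := hD
  obtain ⟨hσ, hvσ, hϖ, -, -, hd1, -⟩ := hD'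
  haveI : IsAdicComplete 𝓂[K] 𝒪[K] := isAdicComplete_valuedInteger_of_completeSpace hϖ
  haveI : Finite 𝓀[K] := Finite.of_fintype _
  obtain ⟨cn, hσcn, hcnv, hcn, hdich⟩ := exists_nonnorm_dichotomy_of_isRamifiedQuadraticDatum σ ϖ d t hD
  have hϖ0 : ϖ ≠ 0 := fun h0 => by rw [h0, map_zero] at hϖ; exact WithZero.coe_ne_zero hϖ.symm
  have hϖ1 : Valued.v ϖ ≤ 1 := by rw [hϖ, ← WithZero.exp_zero, WithZero.exp_le_exp]; norm_num
  have hq : ∀ n : ℕ, Valued.v (ϖ ^ n) = WithZero.exp (-(n : ℤ)) := fun n => by rw [map_pow, v_varpi_pow hϖ]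
  have hN₁ : N₀ ≤ n₁ := hE.2.2.2.2.2.2.2.2.1
  have hmcv : mcOfRecord d = 2 * ((d % 2 + 2 * d - 1 + d) / 2) := rfl
  -- the letters of ★ p861535 §3: `S = G₀ + G₁` is a fixed unit, `|G₁|·|ϖ^{2ρ+s+ℓ₀}| = |ϖ^{n₁}|`
  obtain ⟨-, hS1, hG1v⟩ := v_linearSum_latt_G3 (n₁ := n₁) hD hρ hs hx hy hz k₃ hks k₁ hk₁ hn₁ hM₀ hD₁ hV₁ heC1 heB1
  set G₁ : K := D 1 * (σ x * x) * ((ϖ * σ ϖ) ^ k₁ * eB) with hG₁def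
  set S : K := D 0 * ((ϖ * σ ϖ) ^ k₁ * eB - (ϖ * σ ϖ) ^ k₃ * eC) + G₁ with hSdef
  set c : K := G₁ / S with hcdef
  have hS0 : S ≠ 0 := fun h => by rw [h, map_zero] at hS1; exact zero_ne_one hS1
  have hπ₀σ : σ (ϖ * σ ϖ) = ϖ * σ ϖ := by rw [map_mul, hσ, mul_comm]
  have hπσ : ∀ k : ℕ, σ ((ϖ * σ ϖ) ^ k) = (ϖ * σ ϖ) ^ k := fun k => by rw [map_pow, hπ₀σ]
  have hσG₁ : σ G₁ = G₁ := by
    rw [hG₁def]; simp only [map_mul, (hD₁ 1).1, hσ, hπσ, hσeB]; ring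
  have hσS : σ S = S := by
    rw [hSdef, map_add, hσG₁, map_mul, (hD₁ 0).1, map_sub, map_mul, map_mul, hπσ, hπσ, hσeB, hσeC]
  have hσc : σ c = c := by rw [hcdef, map_div₀, hσG₁, hσS]
  have hone : normSign σ (1 : K) = 1 := normSign_of_isNorm σ ⟨1, by rw [map_one, one_mul]⟩
  have hcv' : Valued.v c = WithZero.exp (((2 * ρ + s + d % 2 : ℕ) : ℤ) - n₁) := by
    have h : Valued.v G₁ * Valued.v (ϖ ^ (2 * ρ + s + d % 2)) = Valued.v (ϖ ^ n₁) := hG1v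
    rw [hq, hq] at h
    have hne : WithZero.exp (-((2 * ρ + s + d % 2 : ℕ) : ℤ)) ≠ 0 := WithZero.exp_ne_zero
    rw [hcdef, map_div₀, hS1, div_one]
    calc Valued.v G₁ = Valued.v G₁ * WithZero.exp (-((2 * ρ + s + d % 2 : ℕ) : ℤ)) * (WithZero.exp (-((2 * ρ + s + d % 2 : ℕ) : ℤ)))⁻¹ := by
          rw [mul_inv_cancel_right₀ hne]
      _ = WithZero.exp (-(n₁ : ℤ)) * (WithZero.exp (-((2 * ρ + s + d % 2 : ℕ) : ℤ)))⁻¹ := by rw [h]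
      _ = WithZero.exp (((2 * ρ + s + d % 2 : ℕ) : ℤ) - n₁) := by rw [← WithZero.exp_neg, ← WithZero.exp_add]; congr 1; ring
  -- normalisation, fibre, stabiliser tube (★ p861251)
  have hzle : Valued.v z ≤ 1 := by rw [hz, hq, ← WithZero.exp_zero, WithZero.exp_le_exp]; omega
  have hnorm := isNormalisedLattice_latt_G3 hϖ1 hx hy hzle ρ s
  rw [← hM₀] at hnorm
  have hcoset := fibre_isCoset_zero hvσ ϖ (Matrix.GeneralLinearGroup.mkOfDetNeZero _ (det_latt_G3_ne_zero hϖ0 x y z ρ s)) hM₀ hnorm _ hD₁ hV₁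
  have hSF : ∀ u ∈ fixedUnitStabilizer σ M₀,
      (∀ j, Valued.v ((u j : Kˣ) : K) = 1) ∧ (∀ j, σ ((u j : Kˣ) : K) = (u j : Kˣ)) ∧
        Valued.v (((u 1 : Kˣ) : K) / ((u 0 : Kˣ) : K) - 1) ≤ Valued.v (ϖ ^ (ρ + s)) := by
    intro u hu
    obtain ⟨huv, huσ⟩ := (mem_fixedUnitTorus_iff σ u).1 (Subgroup.mem_inf.1 (show u ∈ fixedUnitStabilizer σ M₀ from hu)).2
    have hu' := hu
    rw [hM₀] at hu'
    have h10 := (v_sub_le_of_mem_fixedUnitStabilizer_latt_G3 σ hϖ0 hϖ1 hx hz hu').1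
    refine ⟨huv, huσ, ?_⟩
    rw [show ((u 1 : Kˣ) : K) / ((u 0 : Kˣ) : K) - 1 = (((u 1 : Kˣ) : K) - (u 0 : Kˣ)) / ((u 0 : Kˣ) : K) by field_simp, map_div₀, huv 0, div_one]
    exact h10
  -- the §1 depth letters for `c` at `r = ρ + s`
  have hsmall : Valued.v (ϖ ^ (ρ + s)) * Valued.v c < 1 := by
    rw [hq, hcv', ← WithZero.exp_add, ← WithZero.exp_zero, WithZero.exp_lt_exp]; push_cast; omega
  have hdepth : Valued.v (ϖ ^ (ρ + s)) * Valued.v (ϖ ^ (ρ + s)) * Valued.v c * max (Valued.v c) 1 ≤ Valued.v ϖ ^ (2 * d - 1) := by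
    rcases le_total (Valued.v c) 1 with hc1 | hc1
    · have hle : ((2 * ρ + s + d % 2 : ℕ) : ℤ) - n₁ ≤ 0 := by rwa [hcv', ← WithZero.exp_zero, WithZero.exp_le_exp] at hc1
      rw [max_eq_right hc1, mul_one, hcv', hq, v_varpi_pow hϖ, ← WithZero.exp_add, ← WithZero.exp_add, WithZero.exp_le_exp]; push_cast; omega
    · have hle : 0 ≤ ((2 * ρ + s + d % 2 : ℕ) : ℤ) - n₁ := by rwa [hcv', ← WithZero.exp_zero, WithZero.exp_le_exp] at hc1
      rw [max_eq_left hc1, hcv', hq, v_varpi_pow hϖ, ← WithZero.exp_add, ← WithZero.exp_add, ← WithZero.exp_add, WithZero.exp_le_exp]; push_cast; omega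
  -- THE CHARACTER `λ(u) = ω(u₀)·ω(1 + (u₁∕u₀ − 1)·c)`: ±1-valued, multiplicative, the label reads `ω(S)·λ(u) = 1`, trivial on `N′`
  have hval : ∀ u ∈ fixedUnitStabilizer σ M₀,
      normSign σ ((u 0 : Kˣ) : K) * normSign σ (1 + (((u 1 : Kˣ) : K) / ((u 0 : Kˣ) : K) - 1) * c) = 1 ∨
        normSign σ ((u 0 : Kˣ) : K) * normSign σ (1 + (((u 1 : Kˣ) : K) / ((u 0 : Kˣ) : K) - 1) * c) = -1 := by
    intro u _
    rcases normSign_eq_one_or σ ((u 0 : Kˣ) : K) with h0 | h0 <;>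
      rcases normSign_eq_one_or σ (1 + (((u 1 : Kˣ) : K) / ((u 0 : Kˣ) : K) - 1) * c) with h1 | h1 <;> simp [h0, h1]
  have hΛ : ∀ u ∈ fixedUnitStabilizer σ M₀,
      valueClassLabel σ ϖ (α - 1) (β - 1) (d % 2 + 2 * d - 1) d M₀ (fun k => D k * ((u k : Kˣ) : K)) ↔
        normSign σ S * (normSign σ ((u 0 : Kˣ) : K) * normSign σ (1 + (((u 1 : Kˣ) : K) / ((u 0 : Kˣ) : K) - 1) * c)) = 1 := by
    intro u hu
    obtain ⟨huv, huσ, h10⟩ := hSF u hu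
    have hread := twoSlotLabel_latt_G3 hD h2d hE hmc T hT hρ hs hx hy hz k₃ hks hk₃ k₁ hk₁ hn₁ hM₀ hTM hD₁ hV₁ hlev hnlev hsq hσeC heC hσeB heB u hu
    have hlin : ((u 0 : Kˣ) : K) * (D 0 * ((ϖ * σ ϖ) ^ k₁ * eB - (ϖ * σ ϖ) ^ k₃ * eC)) + ((u 1 : Kˣ) : K) * G₁ =
        S * ((u 0 : Kˣ) : K) * (1 + (((u 1 : Kˣ) : K) / ((u 0 : Kˣ) : K) - 1) * c) :=
      linear_eq_sum_mul_one_add (u 0).ne_zero hS0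
    rw [hread, hlin]
    -- `w = 1 + (u₁∕u₀ − 1)·c` is a fixed unit
    have hwv : Valued.v ((((u 1 : Kˣ) : K) / ((u 0 : Kˣ) : K) - 1) * c) < 1 := by
      rw [map_mul]; exact (mul_le_mul' h10 le_rfl).trans_lt hsmall
    have hw1 : Valued.v (1 + (((u 1 : Kˣ) : K) / ((u 0 : Kˣ) : K) - 1) * c) = 1 := Valued.v.map_one_add_of_lt hwv
    have hw0 : 1 + (((u 1 : Kˣ) : K) / ((u 0 : Kˣ) : K) - 1) * c ≠ 0 := fun h => by rw [h, map_zero] at hw1; exact zero_ne_one hw1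
    have hσw : σ (1 + (((u 1 : Kˣ) : K) / ((u 0 : Kˣ) : K) - 1) * c) = 1 + (((u 1 : Kˣ) : K) / ((u 0 : Kˣ) : K) - 1) * c := by
      rw [map_add, map_one, map_mul, map_sub, map_div₀, huσ 1, huσ 0, map_one, hσc]
    have hσSu : σ (S * ((u 0 : Kˣ) : K)) = S * ((u 0 : Kˣ) : K) := by rw [map_mul, hσS, huσ 0]
    rw [normSign_mul_of_fixed hD hσSu hσw (mul_ne_zero hS0 (u 0).ne_zero) hw0, normSign_mul_of_fixed hD hσS (huσ 0) hS0 (u 0).ne_zero, mul_assoc]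
  have hmul : ∀ u ∈ fixedUnitStabilizer σ M₀, ∀ u' ∈ fixedUnitStabilizer σ M₀,
      normSign σ (((u * u') 0 : Kˣ) : K) * normSign σ (1 + ((((u * u') 1 : Kˣ) : K) / (((u * u') 0 : Kˣ) : K) - 1) * c) =
        (normSign σ ((u 0 : Kˣ) : K) * normSign σ (1 + (((u 1 : Kˣ) : K) / ((u 0 : Kˣ) : K) - 1) * c)) *
          (normSign σ ((u' 0 : Kˣ) : K) * normSign σ (1 + (((u' 1 : Kˣ) : K) / ((u' 0 : Kˣ) : K) - 1) * c)) := by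
    intro u hu u' hu'
    obtain ⟨huv, huσ, h10⟩ := hSF u hu
    obtain ⟨huv', huσ', h10'⟩ := hSF u' hu'
    have e0 : (((u * u') 0 : Kˣ) : K) = ((u 0 : Kˣ) : K) * ((u' 0 : Kˣ) : K) := by rw [Pi.mul_apply, Units.val_mul]
    have e1 : (((u * u') 1 : Kˣ) : K) / (((u * u') 0 : Kˣ) : K) = (((u 1 : Kˣ) : K) / ((u 0 : Kˣ) : K)) * (((u' 1 : Kˣ) : K) / ((u' 0 : Kˣ) : K)) := by
      rw [Pi.mul_apply, Pi.mul_apply, Units.val_mul, Units.val_mul]; field_simp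
    have hσt : σ (((u 1 : Kˣ) : K) / ((u 0 : Kˣ) : K)) = ((u 1 : Kˣ) : K) / ((u 0 : Kˣ) : K) := by rw [map_div₀, huσ 1, huσ 0]
    have hσt' : σ (((u' 1 : Kˣ) : K) / ((u' 0 : Kˣ) : K)) = ((u' 1 : Kˣ) : K) / ((u' 0 : Kˣ) : K) := by rw [map_div₀, huσ' 1, huσ' 0]
    rw [e1, e0, normSign_mul_of_fixed hD (huσ 0) (huσ' 0) (u 0).ne_zero (u' 0).ne_zero,
      normSign_one_add_mul_mul hD hσc (r := ρ + s) (by omega) hsmall hdepth hσt hσt' h10 h10']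
    ring
  -- `N′ ≤ S_F` and `λ ≡ 1` on `N′` (torus-equivariance of the value-class label)
  have hNS := map_unitNormMap_unitStabilizer_le σ hσ ϖ 0 hD₁ hV₁ hcoset
  have hε : (normSign σ S : ℤ) = 1 ∨ (normSign σ S : ℤ) = -1 := normSign_eq_one_or σ S
  have hval' : ∀ u ∈ fixedUnitStabilizer σ M₀,
      normSign σ S * (normSign σ ((u 0 : Kˣ) : K) * normSign σ (1 + (((u 1 : Kˣ) : K) / ((u 0 : Kˣ) : K) - 1) * c)) = 1 ∨
        normSign σ S * (normSign σ ((u 0 : Kˣ) : K) * normSign σ (1 + (((u 1 : Kˣ) : K) / ((u 0 : Kˣ) : K) - 1) * c)) = -1 := by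
    intro u hu
    rcases hε with h0 | h0 <;> rcases hval u hu with h1 | h1 <;> simp [h0, h1]
  have hN : ∀ n ∈ (unitStabilizer M₀).map (unitNormMap σ 3),
      normSign σ ((n 0 : Kˣ) : K) * normSign σ (1 + (((n 1 : Kˣ) : K) / ((n 0 : Kˣ) : K) - 1) * c) = 1 := by
    intro n hn
    have key := classSign_mul_eq_of_label (D₁ := D) (isTorusEquivariantLabel_valueClassLabel σ ϖ (α - 1) (β - 1) (d % 2 + 2 * d - 1) d) hNS
      (lam := fun u => normSign σ S * (normSign σ ((u 0 : Kˣ) : K) * normSign σ (1 + (((u 1 : Kˣ) : K) / ((u 0 : Kˣ) : K) - 1) * c)))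
      hval' hΛ (one_mem _) hn
    have h1 : normSign σ (((1 : Fin 3 → Kˣ) 0 : Kˣ) : K) * normSign σ (1 + ((((1 : Fin 3 → Kˣ) 1 : Kˣ) : K) / (((1 : Fin 3 → Kˣ) 0 : Kˣ) : K) - 1) * c) = 1 := by
      simp only [Pi.one_apply, Units.val_one, div_one, sub_self, zero_mul, add_zero, hone, mul_one]
    simp only [one_mul] at key
    rw [h1, mul_one] at key
    rcases hε with h0 | h0
    · rw [h0, one_mul] at key; exact key
    · rw [h0, neg_one_mul, neg_eq_iff_eq_neg] at key
      rcases hval n (hNS hn) with h | h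
      · exact h
      · rw [h] at key; norm_num at key
  exact labelledOddCount_div_relIndex_eq_of_character hσ hvσ hσcn hcnv hcn hdich hfin hD₁ hV₁ hcoset
    (valueClassLabel σ ϖ (α - 1) (β - 1) (d % 2 + 2 * d - 1) d) i hε hmul hval hN hΛ

end Head

end Summit.HodgeConjecture.HodgeConjecture.Cruxes.H413.F0P3cDyRamLabelledOddBoundaryValueG3

end
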